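import Summits.QuantumFields.BalabanUV.Beta.FP.WardPairRankObstructionTorus
import Summits.QuantumFields.BalabanUV.Beta.FP.PeriodisedFormIndexWardDoubled

/-!
# `BalabanUV.Beta.FP.WardPairRankObstructionWilson` — road «FP» for binder row D1, ROUTE T: **F-FP-18-2 (3) AT LEVEL 0 WITH NO HYPOTHESIS LEFT** —
# for the PERIODISED WILSON FIRST-ORDER FORM TABLE (an3's `StepJetData.wilsonA`, the level-0 field–field first-order table of record, periodised on the
# fine torus by leaf-05 g27 `PeriodisedFormIndexWardDoubled`), the UN-LIFTED two-sided Ward pair `a1 ∧ a1t` of the level-0 torus call has NO witnesses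
# along some basis bond — on EVERY torus `d ≥ 1`, `Lc ≥ 2`, `Lc ∣ M′`

WHAT.  `WardPairRankObstructionTorus.torus_exists_live_not_wardPair_of_presentation` (leaf-02, INTENT 9 §2) left exactly ONE displayed hypothesis — the
antisymmetry `H₁ᵀ = −H₁` of the first-order form table (the dictionary's Q-FP-18-2).  At level 0 the first-order field–field form table of record is the
Wilson table, and leaf-05 g27's `PeriodisedFormIndexWardDoubled.torus_H1_transpose` (p322868 ✓) PROVES that its periodisation along ANY weight is an
antisymmetric matrix (`StepJetData.wilsonA_antisymm`, an3).  This file composes the two BY NAME: **`torus_wilson_not_wardPair`** — at `j = 0`, with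
`H₁ := Σ_b [b = b₀] • perF (fine Lc M′) (dper (fine Lc M′) (wilsonA d b.2 b.1))∘(fields, fields)` (the level-0 form jet along the indicator direction) and
leaf-02's generator first jet `W₁^{(δ b₀)}`, for ANY composite averaging block `𝔔₀` presented by the call's `hfμ′ hcoarse′` and ANY gauge block `W₀`:
`∃ b₀, ¬∃ Y₁ Y′₁, (H₁ * W₀ + H₀ * W₁ = 𝔔₀ᵀ * Y₁) ∧ (H₁ᵀ * W₀ + H₀ᵀ * W₁ = 𝔔₀ᵀ * Y′₁)` — NO displayed hypothesis beyond the torus data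
(`hH₀ hQ₁₀ hτ₁` VERBATIM at `j = 0`, `1 ≤ d`, `2 ≤ Lc`, `Lc ∣ M′ᵢ`, `r ∈ box`).  READING (the OWNER's F-FP-18-2 ∕ (δ) ∕ (α), unchanged): the stripped
level-0 tables cannot be read through the naive un-lifted two-sided letters; the door lifts colour (`ColourLift` ∕ `ColourDoubling(Kkt)`) or fixes the
slice (`NestedStepLawTorusNested`); no landed theorem is contradicted (every road file keeps `a1t` as a FREE letter).  Whether the level-0 `H₁` slot of the
Delta IS this Wilson family is the dictionary's identification (an2) — the theorem is about the named family.  [folklore] composition BY NAME; no `def`,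
no `def … : Prop`, nothing cited, 0 sorry; 0 estimates.

HONEST DEPENDENCY (page 1, mandatory): continuum YM on T⁴ ⇐ BetaPertH ∧ nine spine estimates (0/9 proved); BetaPertH ⇐ (D1) ∧ (D4) ∧ CAP+tail;
G-an2-4 gates asym, D1 and NE2/3/4.  HONEST FRAMING (cell contract, verbatim): «discharging `BetaPertH` makes Bałaban's UV stability UNCONDITIONAL —
a real constructive-QFT result; it is NOT the continuum limit and NOT the Clay problem.»  ABSOLUTE RULE (cell charter, verbatim): «No internally-minted
statement may enter as a cited fact. Every hypothesis is either kernel-proved in this package or a verbatim quotation of a PUBLISHED theorem with page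
reference. The manuscript(s) under audit are NOT citable for their own disputed steps — they are the thing under adjudication; programme-internal
(2001/route/tribunal) claims are never citable.»  0∕4 row-D1 binders; NOT (T-ID), NOT SDF, NOT D1, NOT BetaPertH, NOT continuum, NOT Clay.
Road «FP», D1 formalisation swarm leaf-02 (b2b-balaban-beta-d1-formalise-leaf-02) gen 19, 2026-08-22 (leaf-05 g27 junction offer W-5 l.41296).
No existing file touched.
-/

noncomputable section

open scoped BigOperators

namespace Summit.QuantumFields.BalabanUV.Beta.FP.WardPairRankObstructionWilson

open Matrix Finset
open Literature.Probability.LatticeModels (Torus.proj)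
open Literature.MathematicalPhysics.QuantumFieldTheory.Balaban1983to89
open Literature.MathematicalPhysics.QuantumFieldTheory.Balaban1983to89.Beta
open Literature.MathematicalPhysics.QuantumFieldTheory.LatticeForm (quo)
open B5Prop11Plancherel (fine)
open B6Lemma24Torus (pbox)
open StepJetData (wilsonA)
open AffineAveraging (Site box toSite unitVec)
open OneStepResolventKernel (Fib)
open Summit.QuantumFields.BalabanUV.Beta.BorderedHessian (bhKStepAt stepScale)
open Summit.QuantumFields.BalabanUV.Beta.FP.KernelPeriodisationFib (Idx perF)
open Summit.QuantumFields.BalabanUV.Beta.FP.KernelPeriodisationFibLoc (dper)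
open Summit.QuantumFields.BalabanUV.Beta.FP.TorusGaugeCovariance (tdelta)
open Summit.QuantumFields.BalabanUV.Beta.FP.TorusGaugeCovarianceCoarse (coarsePt)
open Summit.QuantumFields.BalabanUV.Beta.FP.TorusCombRows (Res combRowsT)
open Summit.QuantumFields.BalabanUV.Beta.FP.WardPairRankObstructionTorus (torus_exists_live_not_wardPair_of_presentation)
open Summit.QuantumFields.BalabanUV.Beta.FP.PeriodisedFormIndexWardDoubled (torus_H1_transpose)

variable {d : ℕ} (M' : Fin (d + 1) → ℕ) [∀ μ, NeZero (M' μ)] {Lc : ℕ} [NeZero Lc] {r r' : Fin (d + 1) → ℕ}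

set_option synthInstance.maxSize 1024 in
/-- [folklore] **F-FP-18-2 (3) AT LEVEL 0, HYPOTHESIS-FREE: the un-lifted two-sided Ward pair of the level-0 torus call, with the periodised WILSON
first-order form table and leaf-02's generator first jet along the indicator direction, has NO witnesses along some basis bond `b₀`** — for every torus
`d ≥ 1`, `Lc ≥ 2`, `Lc ∣ M′ᵢ`, every composite averaging block `𝔔₀` presented by the call's `hfμ′ hcoarse′`, every gauge block `W₀`.  Inputs BY NAME:
`WardPairRankObstructionTorus.torus_exists_live_not_wardPair_of_presentation` (the rank count) and leaf-05's
`PeriodisedFormIndexWardDoubled.torus_H1_transpose` (antisymmetry of the periodised Wilson family, from an3's `wilsonA_antisymm`). -/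
theorem torus_wilson_not_wardPair (hd : 1 ≤ d) (hLc2 : 2 ≤ Lc) (hM' : ∀ i, Lc ∣ M' i) (hr : r ∈ box (d + 1) Lc)
    {κ : Type*} [Fintype κ] [DecidableEq κ] (pμ' : κ → ↥(pbox M')) (mμ' : κ → Fin (d + 1))
    (hfμ' : Function.Injective (fun a : κ => ((pμ' a, Sum.inr (mμ' a)) : Idx M' (Fib d))))
    (hcoarse' : ∀ (s : ↥(pbox M')) (m : Fin (d + 1)),
      ((s, Sum.inr m) : Idx M' (Fib d)) ∈ Set.range (fun a : κ => ((pμ' a, Sum.inr (mμ' a)) : Idx M' (Fib d))) ↔ Torus.proj Lc (s : Site (d + 1)) = 0)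
    {H₀ : Matrix (↥(pbox (fine Lc M')) × Fin (d + 1)) (↥(pbox (fine Lc M')) × Fin (d + 1)) ℝ}
    {Q₁₀ : Matrix (↥(pbox M') × Fin (d + 1)) (↥(pbox (fine Lc M')) × Fin (d + 1)) ℝ}
    {τ₁ : Matrix (Res (toSite r) Lc (fine Lc M')) (↥(pbox (fine Lc M')) × Fin (d + 1)) ℝ}
    (hH₀ : H₀ = (perF (fine Lc M') (bhKStepAt d (toSite r) Lc 0)).submatrix
        (fun b : ↥(pbox (fine Lc M')) × Fin (d + 1) => ((b.1, Sum.inl b.2) : Idx (fine Lc M') (Fib d)))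
        (fun b : ↥(pbox (fine Lc M')) × Fin (d + 1) => ((b.1, Sum.inl b.2) : Idx (fine Lc M') (Fib d))))
    (hQ₁₀ : Q₁₀ = (perF (fine Lc M') (bhKStepAt d (toSite r) Lc 0)).submatrix
        (fun a : ↥(pbox M') × Fin (d + 1) => ((coarsePt M' Lc a.1, Sum.inr a.2) : Idx (fine Lc M') (Fib d)))
        (fun b : ↥(pbox (fine Lc M')) × Fin (d + 1) => ((b.1, Sum.inl b.2) : Idx (fine Lc M') (Fib d))))
    (hτ₁ : τ₁ = (combRowsT (toSite r) Lc (fine Lc M')).submatrix id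
        (fun b : ↥(pbox (fine Lc M')) × Fin (d + 1) => ((b.1, Sum.inl b.2) : Idx (fine Lc M') (Fib d))))
    (𝔔₀ : Matrix κ (↥(pbox (fine Lc M')) × Fin (d + 1)) ℝ)
    (W₀ : Matrix (↥(pbox (fine Lc M')) × Fin (d + 1)) (Res (toSite r') Lc M' ⊕ Res (toSite r) Lc (fine Lc M')) ℝ) :
    ∃ b₀ : ↥(pbox (fine Lc M')) × Fin (d + 1),
      ∀ {W₁ : Matrix (↥(pbox (fine Lc M')) × Fin (d + 1)) (Res (toSite r') Lc M' ⊕ Res (toSite r) Lc (fine Lc M')) ℝ},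
      -- leaf-02's generator first jet (p318378's `hW₁` shape) at level 0 along the indicator direction `[· = b₀]`
      W₁ = ∑ b : ↥(pbox (fine Lc M')) × Fin (d + 1), (if b = b₀ then (1 : ℝ) else 0) •
        Matrix.of (fun (b' : ↥(pbox (fine Lc M')) × Fin (d + 1)) (e : Res (toSite r') Lc M' ⊕ Res (toSite r) Lc (fine Lc M')) =>
          if b' = b then
            -((((Lc : ℝ) ^ (d + 1) * stepScale d Lc 0)⁻¹)
              * Sum.elim (fun t : Res (toSite r') Lc M' => tdelta M' (quo Lc ((b.1 : Site (d + 1)) + unitVec b.2)) t.1)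
                  (fun s : Res (toSite r) Lc (fine Lc M') => tdelta (fine Lc M') ((b.1 : Site (d + 1)) + unitVec b.2) s.1) e)
          else 0) →
      ¬ ∃ Y₁ Y'₁ : Matrix κ (Res (toSite r') Lc M' ⊕ Res (toSite r) Lc (fine Lc M')) ℝ,
        -- the periodised WILSON first-order form table along the indicator direction, and its transpose
        (∑ b : ↥(pbox (fine Lc M')) × Fin (d + 1), (if b = b₀ then (1 : ℝ) else 0) •
            (perF (fine Lc M') (dper (fine Lc M') (wilsonA d b.2 (b.1 : Site (d + 1))))).submatrix
              (fun b : ↥(pbox (fine Lc M')) × Fin (d + 1) => ((b.1, Sum.inl b.2) : Idx (fine Lc M') (Fib d)))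
              (fun b : ↥(pbox (fine Lc M')) × Fin (d + 1) => ((b.1, Sum.inl b.2) : Idx (fine Lc M') (Fib d)))) * W₀ + H₀ * W₁ = 𝔔₀ᵀ * Y₁ ∧
        (∑ b : ↥(pbox (fine Lc M')) × Fin (d + 1), (if b = b₀ then (1 : ℝ) else 0) •
            (perF (fine Lc M') (dper (fine Lc M') (wilsonA d b.2 (b.1 : Site (d + 1))))).submatrix
              (fun b : ↥(pbox (fine Lc M')) × Fin (d + 1) => ((b.1, Sum.inl b.2) : Idx (fine Lc M') (Fib d)))
              (fun b : ↥(pbox (fine Lc M')) × Fin (d + 1) => ((b.1, Sum.inl b.2) : Idx (fine Lc M') (Fib d))))ᵀ * W₀ + H₀ᵀ * W₁ = 𝔔₀ᵀ * Y'₁ := by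
  obtain ⟨b₀, h⟩ := torus_exists_live_not_wardPair_of_presentation M' hd hLc2 hM' hr 0 pμ' mμ' hfμ' hcoarse' hH₀ hQ₁₀ hτ₁ 𝔔₀ W₀
  exact ⟨b₀, fun hW₁ => h _ hW₁ (torus_H1_transpose (fine Lc M') fun b => if b = b₀ then (1 : ℝ) else 0)⟩

end Summit.QuantumFields.BalabanUV.Beta.FP.WardPairRankObstructionWilson

end
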